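import Summits.HodgeConjecture.HodgeConjecture.Theses.EndoscopicMiddleDegree
import Literature.AlgebraicTopology.SingularHomology.FiniteDeckTransfer
import Literature.AlgebraicTopology.SingularHomology.CohomologyRingChange

/-!
# Line `conjugate-dimension-sieve` for crux `EndoscopicMiddleDegree.MiddleThetaSpan` (stmt-HodgeConjecture-13661)

Skeleton (crux-plan, planner-cruxplan-stmt-HodgeConjecture-13661-conjugate-dimension--0, 2026-08-16) of
idea card `Cruxes/MiddleThetaSpan/Ideas/conjugate-dimension-sieve.md` (crux-ideate r1 ideator 1; triage
r1-1: **pass**, with the sharpening "the core enumeration is wrong — even constituents can own the middle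
coordinate; state CoreVanishing for Ψ₅-, Ψ₄-, Ψ₃-, Ψ₂-cores and as a BET", both built in below).

THE CRUX (verbatim, rank 2, THE HEART of route EndoscopicMiddleDegree): for `m ∈ {1,2}`, `n = m+1`,
`D : UnitaryBallQuotientDatum (2n) X` (`X(ℂ) ≅ Γ\𝔹²ⁿ`, `Γ ⊂ U(V)(F)`, `dim_E V = 2n+1`) every RATIONAL
class `c ∈ H²ⁿ(X(ℂ); ℂ)` of Hodge type `(n,n)` lies in the typed span
`SCⁿ(D) ⊔ span{SCⁿ⁻¹(D) ∪ N¹} ⊔ span{Hdg^{n-1,n-1}_ℚ ∪ N¹}` (`typedSpan m X D`, definitionally the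
crux's right-hand side: `middleThetaSpan_iff` is `Iff.rfl`).

THE LINE (Pohlmann's CM criterion transplanted to Hecke-isotypic pieces; AH-free). Write
`H := H²ⁿ(X(ℂ); ℂ)`, `P := ker(· ∪ ℓ) ⊆ H` the primitive part for a Hecke-invariant Lefschetz class
`ℓ` (intended: `c₁(K_X)`, ample on a ball quotient), and let `𝓗 ⊆ End_ℂ H` be the ℂ-algebra generated
by the CLASSICAL HECKE OPERATORS `T_g = τ ∘ q_g^*` of `g ∈ U(V)(F)` (`HeckeDatum`: the Hecke
correspondence of `g` presented on a finite regular cover `N\𝔹 → Γ\𝔹 = X(ℂ)`, `N ≤ Γ ∩ g⁻¹Γg`, with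
the tree's transfer `FiniteDeckCover.transferMap`; the presentation is PINNED by the uniformization
`D.unif`, so `heckeAlgebra D k` is a genuine definition, not a hypothesis structure). The pieces of the
line are the images `e(P)` of the primitive central idempotents `e` of `𝓗` (= the `π_f`-isotypic
components of the primitive middle cohomology, Matsushima; `e ↔ π_f` up to twist-class on the
component `Γ\𝔹`), and `σ ∈ Aut(ℂ)` acts on `H = H²ⁿ(X(ℂ); ℚ) ⊗ ℂ` through the coefficients
(`conjAct`, the tree's `singularCohomology.ringChange σ`), permuting the pieces: `e ↦ e^σ`
(`IsConjugate`). Every piece is of exactly one of three kinds (pure logic):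
(T) TATE TYPE — `e(P)` and every conjugate `e^σ(P)` are purely of type `(n,n)` (`IsTateType`;
    automorphically: `Σ(σπ_f) = {A(n,n)}` for all `σ`, the sign-selected singleton pieces);
(K) KILLED — some conjugate `e^σ(P)` (possibly `e(P)` itself) carries no non-zero `(n,n)`-class
    (`IsKilledType`; automorphically: a singleton at `π_f` whose character `χ₀` is not parallel);
(C) CORE — neither (`IsCoreType`; automatically every conjugate carries an `(n,n)`-class and some
    conjugate also another type; by Arthur's multiplicity formula + `stub_sieve` (b) these are exactly
    the `π_f` whose parameter has a constituent of dimension `d ≥ 2` owning the middle `τ₁`-coordinate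
    at every real place — the triage-corrected core list Ψ₅ (stable), Ψ₄ ∋ 0, 3+2, 3+1+1, Ψ₂ ∋ 0).
* `stub_lefschetzSplit` (KNOWN, Hodge theory): a Hecke-invariant rational algebraic Lefschetz class `ℓ`
  exists and every rational `(n,n)`-class is `c = c₀ + a ∪ ℓ`, `c₀ ∈ P` rational `(n,n)`, `a` rational
  `(n-1,n-1)` — so `a ∪ ℓ` is in the THIRD typed summand outright.
* `stub_heckeIdempotents` + `stub_heckeHodgeType` (KNOWN in print, Matsushima + BMM Thm 61; lead's
  reshape 2026-08-16 of the planner's `stub_heckePieces`, dropping its unused semisimplicity and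
  `P`-stability conjuncts): `𝓗` has a finite complete family of primitive central idempotents, and
  preserves Hodge type `(n,n)`.
* `stub_sieve` (THE LEVER, provable now: naturality of transfer/pull-back in the coefficients + linear
  algebra): conjugates `e^σ` of primitive central idempotents exist and are primitive central; for a
  RATIONAL class `c`, `e c = 0 ↔ e^σ c = 0` (fact (a) of the card); `dim e(P) = dim e^σ(P)` (fact (b)).
* `stub_singletonSpan` (BET 1, the theta half; idea `definite-twin-theta`): a Tate-type piece lies in
  the typed span.
* `stub_coreVanishing` (BET 2, the honest residue; idea `lefschetz-one-rank-down` covers the 3+1+1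
  Ψ₃-cores): a core piece carries no component of a rational primitive `(n,n)`-class.
* `MiddleThetaSpan_of` — the kernel-checked composition: split `c = c₀ + a ∪ ℓ`; `c₀ = Σ_{e ∈ s} e c₀`
  (`stub_heckeIdempotents`); per `e`: (T) ⇒ `e c₀ ∈ e(P) ⊆ span`; (K) ⇒ `e^σ c₀` is an `(n,n)`-class in a killed piece, hence `0`,
  hence `e c₀ = 0` by the sieve; (C) ⇒ `e c₀ = 0` by CoreVanishing; and `a ∪ ℓ ∈` third summand.

WHAT THE SIEVE BUYS (why this is not the route's expected proof): the kill of (K) and the reduction of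
the crux to (T)-span + (C)-vanishing use NO absolute-Hodge / Tate hypothesis (crux
`BallQuotientHodgeAbsolute`, stmt-14348, is bypassed): rationality is consumed exactly once, in
`stub_sieve` (a) (`σ` fixes rational classes), through COEFFICIENT conjugation of Betti cohomology —
never through conjugation of the variety or of de Rham cohomology.

Disproof.lean: NONE exists for this crux at planning time (payload `disproof_path`
run/sessions/refuter-cdisprove-stmt-HodgeConjecture-13661-0/folder/Disproof.lean is absent on this hub;
`ledger crux ls stmt-HodgeConjecture-13661` lists Ideas/ and TRIAGE-r1-1.md only; no
`Theorems/MiddleThetaSpan/Negative/*` lemma has landed), so no `_false_without_<H>` obstruction is on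
record. Honoured instead: the refuter crux-attack (ATTACK.md, 2026-08-15T20:16Z) — the mutation "drop
`IsRationalClass` ⟹ presumably false" is respected (`stub_sieve` (a) and `stub_coreVanishing` are
stated for rational classes only; the line USES rationality, at `stub_sieve`), and its risk R1
(per-level spanning) is carried by `stub_singletonSpan` verbatim. Negatives index (`ledger negatives
--problem HodgeConjecture`, 2 refuted: ELineTransport 22×22 matrix identity stmt-12555, Fermat-K3
multiset exhaustion stmt-11121): unrelated shapes; no stub is an instance of either.
-/

noncomputable section

namespace Summit.HodgeConjecture.HodgeConjecture.Cruxes.MiddleThetaSpan.ConjugateDimensionSieve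

open scoped BigOperators
open Literature.AlgebraicGeometry.Motives (SchemeOver ComplexPoints)
open Literature.AlgebraicGeometry.HodgeTheory
open Literature.AlgebraicGeometry.ShimuraVarieties
open Literature.AlgebraicTopology.SingularHomology
open Summit.HodgeConjecture.HodgeConjecture.Theses.EndoscopicMiddleDegree

set_option linter.unusedVariables false
set_option linter.dupNamespace false

variable {p : ℕ} {X : SchemeOver ℂ}

/-! ## Vocabulary: classical Hecke operators of `Γ\𝔹`, pinned by the uniformization -/

/-- **Hecke datum** for `g ∈ U(V)(F)` on the ball quotient `X(ℂ) ≅ Γ\𝔹` of `D`: a presentation of the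
Hecke correspondence `Γv ↦ Σ_{γ ∈ N\Γ} Γgγv` on a FINITE REGULAR COVER. Data: a subgroup `N ≤ Γ` with
`gNg⁻¹ ≤ Γ` (so `N ≤ Γ ∩ g⁻¹Γg`); a finite regular covering `cov : E → X(ℂ)` (the tree's
`FiniteDeckCover`, deck group `G`); a second continuous map `q : E → X(ℂ)`; and a map `u : ℂ^{p+1} → E`
which on the negative cone is continuous, onto `E`, has fibres exactly the `N·ℂˣ`-orbits, and satisfies
`cov ∘ u = unif`, `q ∘ u = unif ∘ g`. These conditions force `E ≅ N\𝔹` over `X(ℂ)` (a continuous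
bijection of coverings of the manifold `X(ℂ)` commuting with the projections is a homeomorphism),
`cov = (Nv ↦ Γv)`, `q = (Nv ↦ Γgv)`; the intended instances (`N` = a normal finite-index subgroup of
`Γ ∩ g⁻¹Γg`, `E = N\𝔹`, `G = Γ/N`) exist for every `g ∈ U(V)(F)` (congruence `Γ`; torsion-freeness
makes `Γ/N` act freely), but are not constructed here. [BMM arXiv:1306.1515 Part 2 §1.8 (`ℋ_K`);
Shimura, Introduction to the arithmetic theory of automorphic functions (1971), Ch. 3 (the Hecke ring
of `(Γ, G(ℚ))`) and Ch. 7 (Hecke operators as algebraic correspondences, acting by `p₁_* ∘ p₂^*`).] -/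
structure HeckeDatum (D : UnitaryBallQuotientDatum p X) (g : GL (Fin (p + 1)) D.E) where
  /-- The level of the auxiliary cover, `N ≤ Γ ∩ g⁻¹Γg`. -/
  N : Subgroup (GL (Fin (p + 1)) D.E)
  /-- The deck group of the auxiliary cover (`≅ Γ/N`). -/
  G : Type
  [instGroup : Group G]
  [instFintype : Fintype G]
  /-- The total space of the auxiliary cover (`≅ N\𝔹`). -/
  E : Type
  [instTopologicalSpace : TopologicalSpace E]
  [instMulAction : MulAction G E]
  /-- The finite regular covering `E → X(ℂ)`, `Nv ↦ Γv`. -/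
  cov : FiniteDeckCover G E (ComplexPoints X)
  /-- The twisted projection `E → X(ℂ)`, `Nv ↦ Γgv`. -/
  q : C(E, ComplexPoints X)
  /-- The uniformization of `E` by the negative cone (junk off the cone). -/
  u : (Fin (p + 1) → ℂ) → E
  g_mem : g ∈ unitaryGroup (conjRingHom D.E) D.H
  N_le : N ≤ D.Γ
  conj_mem : ∀ γ ∈ N, g * γ * g⁻¹ ∈ D.Γ
  surjOn_u : Set.SurjOn u D.cone Set.univ
  continuousOn_u : ContinuousOn u D.cone
  proj_u : ∀ v ∈ D.cone, cov.proj (u v) = D.unif v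
  q_u : ∀ v ∈ D.cone, q (u v) = D.unif (D.act g v)
  u_eq_u_iff : ∀ v ∈ D.cone, ∀ w ∈ D.cone,
    u v = u w ↔ ∃ γ ∈ N, ∃ c : ℂ, c ≠ 0 ∧ D.act γ v = c • w

attribute [instance] HeckeDatum.instGroup HeckeDatum.instFintype HeckeDatum.instTopologicalSpace
  HeckeDatum.instMulAction

namespace HeckeDatum

variable {D : UnitaryBallQuotientDatum p X} {g : GL (Fin (p + 1)) D.E}

/-- The (un-normalised) **Hecke operator** of the datum on `Hᵏ(X(ℂ); ℂ)`: pull back along `q` to the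
cover, then transfer (= `[Γ ∩ g⁻¹Γg : N] · T_{ΓgΓ}`; positive integer multiples do not change the
ℂ-algebra generated). -/
def op (Δ : HeckeDatum D g) (k : ℕ) : Module.End ℂ (complexBetti X k) :=
  (Δ.cov.transferMap (R := ℂ) k).hom ∘ₗ (singularCohomology.map ℂ ℂ Δ.q k).hom

end HeckeDatum

/-- The set of classical Hecke operators on `Hᵏ(X(ℂ); ℂ)` (all `g ∈ U(V)(F)`, all presentations). -/
def heckeOperators (D : UnitaryBallQuotientDatum p X) (k : ℕ) :
    Set (Module.End ℂ (complexBetti X k)) :=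
  {T | ∃ (g : GL (Fin (p + 1)) D.E) (Δ : HeckeDatum D g), T = Δ.op k}

/-- The **Hecke algebra** `𝓗 ⊆ End_ℂ Hᵏ(X(ℂ); ℂ)`: the ℂ-subalgebra generated by the classical Hecke
operators (the image of the classical Hecke ring of `(Γ, U(V)(F))` tensored with `ℂ`). -/
def heckeAlgebra (D : UnitaryBallQuotientDatum p X) (k : ℕ) :
    Subalgebra ℂ (Module.End ℂ (complexBetti X k)) :=
  Algebra.adjoin ℂ (heckeOperators D k)

/-- `e` is a **central idempotent** of the subalgebra `A ⊆ End M`. -/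
def IsCentralIdempotent {M : Type*} [AddCommGroup M] [Module ℂ M]
    (A : Subalgebra ℂ (Module.End ℂ M)) (e : Module.End ℂ M) : Prop :=
  e ∈ A ∧ e * e = e ∧ ∀ a ∈ A, a * e = e * a

/-- `e` is a **primitive central idempotent** of `A`: non-zero, central idempotent, and not the sum of
two orthogonal non-zero central idempotents (for `A` semisimple acting faithfully on `M`, the `e(M)` are
exactly the isotypic components of `M`). -/
def IsPrimitiveCentralIdempotent {M : Type*} [AddCommGroup M] [Module ℂ M]
    (A : Subalgebra ℂ (Module.End ℂ M)) (e : Module.End ℂ M) : Prop :=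
  IsCentralIdempotent A e ∧ e ≠ 0 ∧ ∀ f, IsCentralIdempotent A f → f * e = 0 ∨ f * e = e

/-- The **coefficient action** of `σ ∈ Aut(ℂ)` on `Hᵏ(X(ℂ); ℂ) = Hᵏ(X(ℂ); ℚ) ⊗ ℂ`: the tree's change of
coefficient ring along `σ` (additive, `σ`-semilinear, fixes rational classes, commutes with cup
products and with pull-backs/transfers). It conjugates COEFFICIENTS, never the variety. -/
def conjAct (X : SchemeOver ℂ) (σ : ℂ ≃+* ℂ) (k : ℕ) : complexBetti X k →+ complexBetti X k :=
  singularCohomology.ringChange (σ : ℂ →+* ℂ) (ComplexPoints X) k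

/-- `e'` is the **`σ`-conjugate** of the endomorphism `e`: `σ_* ∘ e = e' ∘ σ_*` (for the isotypic
projector `e ↔ π_f` this is `e' ↔ σπ_f`, BMM Part 2 §1.9). -/
def IsConjugate (X : SchemeOver ℂ) (k : ℕ) (σ : ℂ ≃+* ℂ) (e e' : Module.End ℂ (complexBetti X k)) :
    Prop :=
  ∀ x, conjAct X σ k (e x) = e' (conjAct X σ k x)

/-- The **primitive part** `P = ker(· ∪ ℓ : H²ⁿ → H²ⁿ⁺²)` of the middle cohomology `H²ⁿ(X(ℂ); ℂ)`,
`n = m + 1`, for a degree-2 class `ℓ` (Lefschetz: `H²ⁿ = P ⊕ ℓ ∪ H²ⁿ⁻²` when `ℓ` is a Kähler class). -/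
def primitivePart (ℓ : complexBetti X (2 * 1)) (m : ℕ) : Submodule ℂ (complexBetti X (2 * (m + 1))) :=
  LinearMap.ker
    ((cupProduct (Literature.AlgebraicGeometry.HodgeTheory.two_mul_add_two_mul (m + 1) 1)).flip ℓ)

/-- `ℓ ∈ H²(X(ℂ); ℂ)` is a **Hecke-invariant Lefschetz class** for the middle degree `2(m+1)`:
algebraic (a divisor class), rational, HARD LEFSCHETZ across the middle (`· ∪ ℓ ∪ ℓ : H^{2m} → H^{2m+4}`
is bijective — this excludes the degenerate `ℓ = 0`, under which the primitive part would be all of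
`H²ⁿ` and `stub_coreVanishing` false, and is exactly what the Lefschetz split uses), and pulled back
identically by the two projections of every Hecke datum
(`q^* ℓ = cov^* ℓ` on the cover) — as `c₁(K_X)` is (`K_X` is ample on a compact ball quotient and pulls
back to `K` along both local biholomorphisms). By the projection formula every Hecke operator then
commutes with `· ∪ ℓ`; automorphically the Hecke-invariant part of `H²` is the line `ℂ · c₁(K_X)`
(`H²(𝔤,K;𝟙)` is one-dimensional), so these are the classes `r · c₁(K_X)`, `r ∈ ℚˣ`. -/
def IsHeckeLefschetzClass (D : UnitaryBallQuotientDatum p X) (m : ℕ) (ℓ : complexBetti X (2 * 1)) :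
    Prop :=
  ℓ ∈ algebraicClasses X 1 ∧ IsRationalClass ℓ ∧
    Function.Bijective
      ((cupProduct (Literature.AlgebraicGeometry.HodgeTheory.two_mul_add_two_mul (m + 1) 1)).flip ℓ ∘ₗ
        (cupProduct (Literature.AlgebraicGeometry.HodgeTheory.two_mul_add_two_mul m 1)).flip ℓ :
          complexBetti X (2 * m) →ₗ[ℂ] complexBetti X (2 * (m + 1 + 1))) ∧
    ∀ (g : GL (Fin (p + 1)) D.E) (Δ : HeckeDatum D g),
      singularCohomology.map ℂ ℂ Δ.q (2 * 1) ℓ = singularCohomology.map ℂ ℂ Δ.cov.proj (2 * 1) ℓ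

/-- The **typed span** of the crux at `(m, X, D)` — VERBATIM the right-hand side of `MiddleThetaSpan`:
`SC^{m+1}(D) ⊔ span{s ∪ d : s ∈ SC^m(D), d ∈ N¹} ⊔ span{a ∪ d : a rational Hodge (m,m), d ∈ N¹}`. -/
def typedSpan (m : ℕ) (X : SchemeOver ℂ) (D : UnitaryBallQuotientDatum (2 * (m + 1)) X) :
    Submodule ℂ (complexBetti X (2 * (m + 1))) :=
  (⨆ (W : Submodule D.E (Fin (2 * (m + 1) + 1) → D.E))
      (_ : IsTotallyPositive (conjRingHom D.E) D.H W) (_ : Module.finrank D.E W = m + 1),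
      classesSupportedOn X (D.specialSubvariety W) (2 * (m + 1))) ⊔
  Submodule.span ℂ {z : complexBetti X (2 * (m + 1)) |
    ∃ s ∈ (⨆ (W : Submodule D.E (Fin (2 * (m + 1) + 1) → D.E))
      (_ : IsTotallyPositive (conjRingHom D.E) D.H W) (_ : Module.finrank D.E W = m),
      classesSupportedOn X (D.specialSubvariety W) (2 * m)),
      ∃ d ∈ algebraicClasses X 1,
        z = cupProduct (Literature.AlgebraicGeometry.HodgeTheory.two_mul_add_two_mul m 1) s d} ⊔
  Submodule.span ℂ {z : complexBetti X (2 * (m + 1)) |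
    ∃ a : complexBetti X (2 * m), IsRationalClass a ∧
      IsOfHodgeType (2 * (m + 1)) X (2 * m) m m a ∧
      ∃ d ∈ algebraicClasses X 1,
        z = cupProduct (Literature.AlgebraicGeometry.HodgeTheory.two_mul_add_two_mul m 1) a d}

/-- The crux unfolds DEFINITIONALLY to "every rational `(m+1,m+1)`-class lies in `typedSpan m X D`". -/
theorem middleThetaSpan_iff :
    MiddleThetaSpan ↔
      ∀ (m : ℕ) (X : SchemeOver ℂ) (D : UnitaryBallQuotientDatum (2 * (m + 1)) X), 1 ≤ m → m ≤ 2 →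
        ∀ c : complexBetti X (2 * (m + 1)), IsRationalClass c →
          IsOfHodgeType (2 * (m + 1)) X (2 * (m + 1)) (m + 1) (m + 1) c → c ∈ typedSpan m X D :=
  Iff.rfl

/-! ## The trichotomy of Hecke pieces (pure logic; automorphic meaning in the docstrings) -/

section Trichotomy

variable (D : UnitaryBallQuotientDatum p X) (ℓ : complexBetti X (2 * 1)) (m : ℕ)

/-- **(T) Tate type.** The primitive piece `e(P)` of `e` AND of every conjugate `e^σ` is purely of Hodge
type `(m+1, m+1)`. Automorphically (Matsushima + Vogan–Zuckerman): `Σ(σπ_f) = {A(n,n)}` for every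
`σ ∈ Aut(ℂ)` — the sign-selected SINGLETON pieces whose middle character `χ₀` is parallel
(finite order · ‖·‖), i.e. the Tate-type pieces of the card; by `stub_sieve` the rational structure
`e(P) ⊕ conjugates` is then a Hodge–Tate ℚ-Hodge structure. -/
def IsTateType (e : Module.End ℂ (complexBetti X (2 * (m + 1)))) : Prop :=
  (∀ c ∈ (primitivePart ℓ m).map e, IsOfHodgeType p X (2 * (m + 1)) (m + 1) (m + 1) c) ∧
    ∀ (σ : ℂ ≃+* ℂ) (e' : Module.End ℂ (complexBetti X (2 * (m + 1)))),
      IsPrimitiveCentralIdempotent (heckeAlgebra D (2 * (m + 1))) e' → IsConjugate X (2 * (m + 1)) σ e e' →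
        ∀ c ∈ (primitivePart ℓ m).map e', IsOfHodgeType p X (2 * (m + 1)) (m + 1) (m + 1) c

/-- **(K) Killed.** The primitive piece of `e`, or of some conjugate `e^σ`, carries NO non-zero class of
type `(m+1, m+1)`. Automorphically: `A(n,n) ∉ Σ(σπ_f)` for some `σ` — e.g. a singleton at `π_f` whose
character `χ₀` is not parallel; the would-be Hodge-not-Tate pieces. The sieve kills every rational
`(n,n)`-component here (`MiddleThetaSpan_of`, case (K)). -/
def IsKilledType (e : Module.End ℂ (complexBetti X (2 * (m + 1)))) : Prop :=
  (∀ c ∈ (primitivePart ℓ m).map e, IsOfHodgeType p X (2 * (m + 1)) (m + 1) (m + 1) c → c = 0) ∨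
    ∃ (σ : ℂ ≃+* ℂ) (e' : Module.End ℂ (complexBetti X (2 * (m + 1)))),
      IsPrimitiveCentralIdempotent (heckeAlgebra D (2 * (m + 1))) e' ∧ IsConjugate X (2 * (m + 1)) σ e e' ∧
        ∀ c ∈ (primitivePart ℓ m).map e', IsOfHodgeType p X (2 * (m + 1)) (m + 1) (m + 1) c → c = 0

/-- **(C) Core.** Neither Tate type nor killed: every conjugate piece carries a non-zero `(n,n)`-class and
some conjugate piece (possibly `e(P)` itself) also carries another type. By `stub_sieve` (b) (equal
dimensions of conjugate pieces) and Arthur–Mok/KMSW multiplicity one, `|Σ(σπ_f)| = d` is constant in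
`σ`, so these are exactly the `π_f` with `d ≥ 2`: an irreducible constituent of dimension `d ≥ 2` of the
parameter owns the middle `τ₁`-coordinate at every real place (triage r1-1 correction: EVEN `d` occurs —
Ψ₄ ∋ 0 in 4+1, Ψ₂ ∋ 0 in 2+2+1 / 2+1+1+1 / 3+2 — besides Ψ₅ stable, 3+2, 3+1+1 at `p = 4`). -/
def IsCoreType (e : Module.End ℂ (complexBetti X (2 * (m + 1)))) : Prop :=
  ¬ IsTateType D ℓ m e ∧ ¬ IsKilledType D ℓ m e

end Trichotomy

/-! ## The stubs -/

/-- **Stub 1 — Lefschetz split off the primitive part (KNOWN; Hodge theory).** For `m ∈ {1,2}` and a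
datum `D` there is a Hecke-invariant rational algebraic Lefschetz class `ℓ ∈ H²(X(ℂ); ℂ)` such that
every rational class `c` of type `(m+1,m+1)` in the middle degree splits as `c = c₀ + a ∪ ℓ` with `c₀`
rational of type `(m+1,m+1)` and PRIMITIVE (`c₀ ∪ ℓ = 0`) and `a ∈ H^{2m}` rational of type `(m,m)`.
Why plausibly true: take `ℓ = c₁(K_X)` — `K_X` is ample on a compact ball quotient (the Bergman =
invariant Kähler form represents a multiple of `c₁(K)`), so `ℓ` is rational, a divisor class (a multiple
is very ample; `N¹` is a ℂ-subspace), and `q^*ℓ = cov^*ℓ = c₁(K_E)` for every Hecke datum (both maps are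
local biholomorphisms `N\𝔹 → Γ\𝔹`); hard Lefschetz for `L = ℓ ∪ ·` (Voisin I Thm 6.25: `L² : H²ⁿ⁻² ≅
H²ⁿ⁺²` on the `2n`-fold) gives `c' := (L²)⁻¹(L c)`, `c₀ := c - L c'`; `L` is of bidegree `(1,1)` and
defined over ℚ (Rem 6.27, §7.1.2), so `c'` is rational of type `(m,m)` and `c₀` rational of type
`(m+1,m+1)` (the tree records exactly these descent clauses in `HardLefschetzNFold`:
`isRationalClass_L_iff`, `isOfHodgeType_L_iff` at `k + j = dim`). Size M given hard Lefschetz for the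
class `c₁(K_X)` (itself the named fact `nonempty_hardLefschetzNFold`, whose `h` is an unspecified ample
class — the Hecke-invariance clause is why `c₁(K_X)` specifically is wanted). Leans on:
`HardLefschetzNFold`, `lefschetzPowTo`, `IsRationalClass.cup`, `cupProduct`, `algebraicClasses`,
`KaehlerClassHodgeType`. -/
theorem stub_lefschetzSplit :
    ∀ (m : ℕ) (X : SchemeOver ℂ) (D : UnitaryBallQuotientDatum (2 * (m + 1)) X), 1 ≤ m → m ≤ 2 →
      ∃ ℓ : complexBetti X (2 * 1), IsHeckeLefschetzClass D m ℓ ∧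
        ∀ c : complexBetti X (2 * (m + 1)), IsRationalClass c →
          IsOfHodgeType (2 * (m + 1)) X (2 * (m + 1)) (m + 1) (m + 1) c →
          ∃ (c₀ : complexBetti X (2 * (m + 1))) (a : complexBetti X (2 * m)),
            IsRationalClass c₀ ∧ IsOfHodgeType (2 * (m + 1)) X (2 * (m + 1)) (m + 1) (m + 1) c₀ ∧
            c₀ ∈ primitivePart ℓ m ∧
            IsRationalClass a ∧ IsOfHodgeType (2 * (m + 1)) X (2 * m) m m a ∧
            c = c₀ + cupProduct (Literature.AlgebraicGeometry.HodgeTheory.two_mul_add_two_mul m 1) a ℓ := by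
  sorry

/-- **Stub 2a — Hecke idempotents (KNOWN in print: Matsushima's formula, Borel–Wallach VII / BMM
(Mdec) §1.8 and Thm 61; finite-dimensional linear algebra in Lean).** For `m ∈ {1,2}` and a datum
`D`, the Hecke algebra `𝓗 = heckeAlgebra D (2n)` on `H = H²ⁿ(X(ℂ); ℂ)` has a finite family `s` of
primitive central idempotents with `Σ_{e ∈ s} e = 1` (the block decomposition `H = ⊕_e e(H)`; for the
genuine, semisimple `𝓗` these are the `ℚ`-Hecke-isotypic pieces `W([π_f])^Γ ⊗ ℂ`).
Why true: `H` is finite-dimensional (`X(ℂ) ≃ₜ Γ\𝔹` is a compact manifold: datum fields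
`isSmoothProjective`, `homeomorph`; tree `finite_singularHomology_of_compact_chartedSpace` + duality),
so the centre `Z(𝓗) ⊆ End_ℂ H` is a finite-dimensional commutative `ℂ`-algebra; its block idempotents
(projectors onto the simultaneous generalised eigenspaces of `Z(𝓗)`, polynomials in elements of
`Z(𝓗)`) are central, orthogonal, sum to `1`, and are primitive among CENTRAL idempotents (an idempotent
of the local ring `e Z(𝓗)` is `0` or `e`). Semisimplicity (Petersson normality of the `T_g`) is NOT
needed and NOT claimed (lead's reshape 2026-08-16: the planner's `IsSemisimpleRing`/`P`-stability
conjuncts were unused by the composition and are dropped). Size M–L. Leans on: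
`Algebra.adjoin`, `Subalgebra.center`, `Module.End.iSup_maxGenEigenspace_eq_top`,
`IsArtinianRing`, `CompleteOrthogonalIdempotents`, finite-dimensionality of `complexBetti`. -/
theorem stub_heckeIdempotents :
    ∀ (m : ℕ) (X : SchemeOver ℂ) (D : UnitaryBallQuotientDatum (2 * (m + 1)) X), 1 ≤ m → m ≤ 2 →
      ∃ s : Finset (Module.End ℂ (complexBetti X (2 * (m + 1)))),
        (∀ e ∈ s, IsPrimitiveCentralIdempotent (heckeAlgebra D (2 * (m + 1))) e) ∧
        (∑ e ∈ s, e = 1) := by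
  sorry

/-- **Stub 2b — the Hecke algebra preserves the Hodge type `(n,n)` (KNOWN: BMM Thm 61, "`ℋ_K` acts
by algebraic correspondences"; Shimura 1971 Ch. 7).** For `m ∈ {1,2}` and a datum `D`, every element
of `heckeAlgebra D (2n)` maps classes of Hodge type `(n,n)` to classes of Hodge type `(n,n)`.
Why true: a generator `Δ.op = τ ∘ q^*` is pull-back along the local biholomorphism `q : N\𝔹 → Γ\𝔹`
(`q ∘ u = unif ∘ g`, both uniformisations holomorphic: datum field `differentiableOn_unif`) followed by
the trace of the local biholomorphism `cov`; pull-back and trace of harmonic / closed `(p,q)`-forms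
preserve type, and the de Rham comparison of a Hodge model is natural (`HodgeModel.deRham_isNatural`);
sums and composites then preserve the `∃`-over-models predicate `IsOfHodgeType` modulo the model
independence of `H^{p,q}` (`hodgePQ_independent_of_hodgeModel`, natural automorphisms of `Hᵏ(-;ℂ)`
are scalars). Size L–XL in Lean (the cover `E` of a `HeckeDatum` carries no complex structure; it must
be transported from the cone through `u`). Leans on: `HodgeModel`, `IsOfHodgeType`, `HeckeDatum`,
`FiniteDeckCover.transferMap`, `singularCohomology.map`, `Algebra.adjoin_induction`. -/
theorem stub_heckeHodgeType :
    ∀ (m : ℕ) (X : SchemeOver ℂ) (D : UnitaryBallQuotientDatum (2 * (m + 1)) X), 1 ≤ m → m ≤ 2 →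
      ∀ a ∈ heckeAlgebra D (2 * (m + 1)), ∀ c : complexBetti X (2 * (m + 1)),
        IsOfHodgeType (2 * (m + 1)) X (2 * (m + 1)) (m + 1) (m + 1) c →
          IsOfHodgeType (2 * (m + 1)) X (2 * (m + 1)) (m + 1) (m + 1) (a c) := by
  sorry

/-- **Stub 3 — THE SIEVE (the lever; provable now: topology of the transfer + linear algebra).** For
`m ∈ {1,2}` and a datum `D`, on `H = H²ⁿ(X(ℂ); ℂ)`:
(∃) every primitive central idempotent `e` of the Hecke algebra has, for every `σ ∈ Aut(ℂ)`, a conjugate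
`e^σ` (`σ_* ∘ e = e^σ ∘ σ_*`) which is again a primitive central idempotent of the Hecke algebra;
(a) SUPPORT: for conjugate endomorphisms `e, e'` and a RATIONAL class `c`, `e c = 0 ↔ e' c = 0`;
(b) DIMENSION: for conjugate `e, e'` and rational `ℓ`, `dim_ℂ e(P_ℓ) = dim_ℂ e'(P_ℓ)`.
Why plausibly true: `σ_* = conjAct σ` is the change of coefficients along `σ`: additive, bijective
(inverse `conjAct σ⁻¹`; functoriality of `ringChange`), `σ`-semilinear, multiplicative for `∪`
(`ringChange_cupProduct`), FIXES rational classes (`ringChange σ ∘ ringChange (ℚ → ℂ) = ringChange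
(ℚ → ℂ)`, with `isRationalClass_iff_exists_ringChange`), and COMMUTES with every Hecke operator
`T = τ ∘ q^*` (pull-back and transfer are post-composition-natural on cochains: `σ ∘ (Σ_g ψ(g∘ã)) =
Σ_g (σ∘ψ)(g∘ã)`). Hence `a ↦ σ_* a σ_*⁻¹` is a `σ`-semilinear ring automorphism of `End_ℂ H` mapping the
ℂ-span of words in the `T`'s onto itself, i.e. `heckeAlgebra` onto itself, and central / idempotent /
primitive elements to the same (∃). (a): `σ_*(e c) = e'(σ_* c) = e' c` and `σ_*` is injective.
(b): `σ_*` maps `P_ℓ` onto `P_ℓ` (`ℓ` rational) and `e(P_ℓ)` semilinearly-bijectively onto `e'(P_ℓ)`;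
semilinear bijections preserve `Module.rank`, hence `finrank`. This is facts (a)+(b) of the card —
"a rational vector has non-zero image in every conjugate piece", "conjugate pieces have equal dimension"
— with (Hecke field `T`, embeddings) replaced by (primitive central idempotents, `Aut(ℂ)`-conjugation),
which avoids choosing a primitive rational Hecke operator `θ`. Size M. Why it might fail: not
mathematically; Lean-side only if `ringChange` lacks functoriality lemmas (then prove them: S).
Leans on: `singularCohomology.ringChange`, `ringChange_π`, `ringChange_cupProduct`,
`isRationalClass_iff_exists_ringChange`, `ringChange_rat_injective`, `FiniteDeckCover.transfer_f_apply`,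
`singularCochainComplex.map`, `Algebra.adjoin_induction`, `LinearEquiv.finrank_eq` (semilinear form:
`rank` via `LinearIndependent.map` over `σ`). -/
theorem stub_sieve :
    ∀ (m : ℕ) (X : SchemeOver ℂ) (D : UnitaryBallQuotientDatum (2 * (m + 1)) X), 1 ≤ m → m ≤ 2 →
      (∀ (σ : ℂ ≃+* ℂ) (e : Module.End ℂ (complexBetti X (2 * (m + 1)))),
          IsPrimitiveCentralIdempotent (heckeAlgebra D (2 * (m + 1))) e →
            ∃ e' : Module.End ℂ (complexBetti X (2 * (m + 1))),
              IsPrimitiveCentralIdempotent (heckeAlgebra D (2 * (m + 1))) e' ∧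
                IsConjugate X (2 * (m + 1)) σ e e') ∧
      (∀ (σ : ℂ ≃+* ℂ) (e e' : Module.End ℂ (complexBetti X (2 * (m + 1)))),
          IsConjugate X (2 * (m + 1)) σ e e' →
            (∀ c : complexBetti X (2 * (m + 1)), IsRationalClass c → (e c = 0 ↔ e' c = 0)) ∧
            (∀ ℓ : complexBetti X (2 * 1), IsRationalClass ℓ →
              Module.finrank ℂ ↥((primitivePart ℓ m).map e) =
                Module.finrank ℂ ↥((primitivePart ℓ m).map e'))) := by
  sorry

/-- **Stub 4 — SINGLETON SPAN (BET 1: the theta half of the heart).** For `m ∈ {1,2}`, a datum `D`, a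
Hecke-invariant Lefschetz class `ℓ` and a primitive central idempotent `e` of the Hecke algebra of TATE
TYPE (its primitive piece and all conjugate pieces purely `(n,n)`, `n = m+1`): `e(P) ⊆ typedSpan`.
Automorphic content: `e(P) = ⊕ H²ⁿ(𝔤,K; A(n,n)) ⊗ π_f^K` over a twist-class of `π_f` with
`Σ(σπ_f) = {A(n,n)}` for all `σ`; by Arthur–Mok/KMSW the parameter is `Ψ' ⊞ χ₀` with `χ₀` a character at
the middle position at EVERY real place, hence parallel; then (idea `definite-twin-theta`, triage pass):
twin `π'_f` on the definite inner form `U(V')`, `θ_{V'→W}` in the first-term range (Rallis,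
Kudla–Rallis, Gan–Takeda, Yamana), return `θ_{W→V}` in Weil's convergent range (`V` anisotropic) landing
on `A(n,n) ⊗ π_f` WITH the Kudla–Millson vector, and BMM steps 1–3 (Thm 69/71 seesaw `W = W₁ ⊕ W₂`,
range-free) put the piece in `SCⁿ + SCⁿ⁻¹·N¹ +` Lefschetz; `H^{1,1}` and `H^{n-1,n-1}` are defined over ℚ
for `n ≤ 3` (BMM Cor 62), which is why `m ≤ 2`. Equivalently the route's direct `a = 1` criterion
(GlobalCriterion: pole of `L^S(s, π × χ₀⁻¹)` at `s = 1` ⟹ `θ_{V→W}(π) ≠ 0`, the same first-term range).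
Why it might fail: (R1, refuter ATTACK.md §4 / CAVEAT-13661) PER-LEVEL spanning — the crux is at fixed
level `Γ`: the auxiliary `U(W₂″)`-divisors with non-zero seesaw pairing must exist AT LEVEL `Γ`
(push-forward from a finite cover is not a product `s ∪ d`); CAP singleton shapes (`μ⊠R₂ ⊞ χ₀`,
`η⊠R₂ ⊞ η′⊠R₂ ⊞ χ₀`) need Adams–Johnson/AMR packets where labels are not injective (triage: scope the twin
to generic `ψ` first); early theta occurrence at `𝔮`. Size XL (paper mathematics until cohomological
representations / theta lifts are typed). Leans on (print): BMM arXiv:1306.1515 Thm 4, 61, 62, 67, 69,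
71, 72, Prop 80–81; Kudla–Millson 1990; GQT arXiv:1207.4709 §1.7–1.10, Thm 2; Yamana Invent. 196
(2014); Mok arXiv:1206.0882 / KMSW arXiv:1409.3731; AMR arXiv:1507.01432; Sun–Zhu (conservation);
A. Paul 1998/2000 (archimedean theta); tree: `specialCycleClasses_def`, `specialCycleClasses_le_algebraicClasses`,
`classesSupportedOn`, `CorrespondenceAction`. -/
theorem stub_singletonSpan :
    ∀ (m : ℕ) (X : SchemeOver ℂ) (D : UnitaryBallQuotientDatum (2 * (m + 1)) X), 1 ≤ m → m ≤ 2 →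
      ∀ ℓ : complexBetti X (2 * 1), IsHeckeLefschetzClass D m ℓ →
        ∀ e : Module.End ℂ (complexBetti X (2 * (m + 1))),
          IsPrimitiveCentralIdempotent (heckeAlgebra D (2 * (m + 1))) e → IsTateType D ℓ m e →
            (primitivePart ℓ m).map e ≤ typedSpan m X D := by
  sorry

/-- **Stub 5 — CORE VANISHING (BET 2: the honest residue of the heart; HARDEST).** For `m ∈ {1,2}`, a
datum `D`, a Hecke-invariant Lefschetz class `ℓ` and a primitive central idempotent `e` of CORE type
(neither Tate type nor killed), every rational primitive `(n,n)`-class `c` has `e c = 0`: core pieces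
carry no component of a rational Hodge class.
Why plausibly true: by `stub_sieve` (b) + multiplicity one the conjugates `σπ_f` of a core all have
`|Σ(σπ_f)| = d ≥ 2` with `A(n,n) ∈ Σ`: a constituent `Ψ_d` (`d ∈ {2,3,4,5}` at `p = 4`; `≤ 7` at `p = 6`)
of the parameter owns the middle coordinate at every real place, and the `T`-Hodge structure
`N = (e(P) ⊕ conjugates)_ℚ` (`T` = Hecke field) has `d` distinct Hodge types in each embedding. A rational
`(n,n)`-class with `e c ≠ 0` would generate a `T`-sub-Hodge structure of `N` of `T`-rank 1 purely of type
`(n,n)`; so the stub FOLLOWS from the `T`-irreducibility of the Hodge structure `N` (Mumford–Tate side),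
whose Galois analogue — irreducibility of `r(Ψ_d)` — is known in the relevant cases (rank 3:
Blasius–Rogawski; regular algebraic, `n ≤ 5`: Calegari–Gee arXiv:1104.4827, Xia arXiv:1708.00921; density
one: Patrikis–Taylor arXiv:1307.1640), and "Hodge ⟹ Tate" for these motives alone would also finish it
(absolute Hodge for `N` only — far less than crux BallQuotientHodgeAbsolute). Special cycles and divisor
products have zero component in cores (theta-type parameters are `Ψ_W ⊞ χ`, Galois-invariance of
cycle classes), consistent with the crux. Partial tool: idea `lefschetz-one-rank-down` (triage: live
for 3+1+1 Ψ₃-cores of type `(1,0,-1)` at every real place — Ichino–Prasanna-type `T`-linear transporter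
to `H²` of a Picard modular surface, where Lefschetz (1,1) + irreducibility of `r(Ψ₃)(1)` exclude
rational classes; the transporter must be an ISOMORPHISM, two non-vanishing periods). Why it might fail:
ONE rational `(2,2)`-class in ONE core piece of ONE compact `U(4,1)`-quotient refutes it (route kill
criterion (i); most likely from an EVEN core, 4+1 with Ψ₄ ∋ 0, which no theta construction reaches);
tool-less today for Ψ₅/Ψ₄/Ψ₂-cores and 3+2. Size: open-problem-sized (XL+). Leans on (print): Arthur's
multiplicity formula (Mok/KMSW), Clozel Ann Arbor Thm 3.13 (conjugates of regular algebraic `Π`),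
Kottwitz JAMS 5 / Kisin–Shin–Zhu arXiv:2110.05381 (Galois action on `H²ⁿ[π_f]`), the irreducibility
results above, Ichino–Prasanna arXiv:1806.10563; tree: `IsAbsoluteHodgeClass` (NOT used),
`Motives.HodgeStructure`, `hodgeClasses`. -/
theorem stub_coreVanishing :
    ∀ (m : ℕ) (X : SchemeOver ℂ) (D : UnitaryBallQuotientDatum (2 * (m + 1)) X), 1 ≤ m → m ≤ 2 →
      ∀ ℓ : complexBetti X (2 * 1), IsHeckeLefschetzClass D m ℓ →
        ∀ e : Module.End ℂ (complexBetti X (2 * (m + 1))),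
          IsPrimitiveCentralIdempotent (heckeAlgebra D (2 * (m + 1))) e → IsCoreType D ℓ m e →
            ∀ c ∈ primitivePart ℓ m, IsRationalClass c →
              IsOfHodgeType (2 * (m + 1)) X (2 * (m + 1)) (m + 1) (m + 1) c → e c = 0 := by
  sorry

/-! ## The composition (kernel-checked, no `sorry` of its own) -/

/-- **`MiddleThetaSpan` from the six stubs.** Split `c = c₀ + a ∪ ℓ` (`stub_lefschetzSplit`); the
Lefschetz part `a ∪ ℓ` is a generator of the third typed summand. Decompose `c₀ = Σ_{e ∈ s} e c₀` along
the primitive central idempotents (`stub_heckeIdempotents`, Hodge compatibility `stub_heckeHodgeType`) and run the trichotomy per `e`: Tate type ⇒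
`e c₀ ∈ e(P) ⊆ typedSpan` (`stub_singletonSpan`); killed ⇒ the killed conjugate `e'` has `e' c₀ = 0`
(an `(n,n)`-class in `e'(P)`, Hodge compatibility of the Hecke algebra), hence `e c₀ = 0` by the SIEVE
(`stub_sieve` (a), `c₀` rational); core ⇒ `e c₀ = 0` (`stub_coreVanishing`). -/
theorem MiddleThetaSpan_of : MiddleThetaSpan := by
  intro m X D hm1 hm2 c hc hH
  change c ∈ typedSpan m X D
  obtain ⟨ℓ, hℓ, hsplit⟩ := stub_lefschetzSplit m X D hm1 hm2
  obtain ⟨c₀, a, hc₀Q, hc₀H, hc₀P, haQ, haH, rfl⟩ := hsplit c hc hH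
  obtain ⟨s, hprim, hsum⟩ := stub_heckeIdempotents m X D hm1 hm2
  have hstabH := stub_heckeHodgeType m X D hm1 hm2
  refine Submodule.add_mem _ ?_ ?_
  · -- the primitive part, piece by piece
    have hc₀eq : c₀ = ∑ e ∈ s, e c₀ := by
      rw [← LinearMap.sum_apply, hsum]; rfl
    rw [hc₀eq]
    refine Submodule.sum_mem _ fun e he => ?_
    by_cases hT : IsTateType D ℓ m e
    · -- (T): singleton span
      exact stub_singletonSpan m X D hm1 hm2 ℓ hℓ e (hprim e he) hT (Submodule.mem_map_of_mem hc₀P)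
    · by_cases hK : IsKilledType D ℓ m e
      · -- (K): the sieve
        have h0 : e c₀ = 0 := by
          rcases hK with hk | ⟨σ, e', he', hconj, hk⟩
          · exact hk _ (Submodule.mem_map_of_mem hc₀P) (hstabH e (hprim e he).1.1 c₀ hc₀H)
          · have h0' : e' c₀ = 0 :=
              hk _ (Submodule.mem_map_of_mem hc₀P) (hstabH e' he'.1.1 c₀ hc₀H)
            exact (((stub_sieve m X D hm1 hm2).2 σ e e' hconj).1 c₀ hc₀Q).2 h0'
        rw [h0]
        exact Submodule.zero_mem _
      · -- (C): core vanishing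
        have h0 : e c₀ = 0 :=
          stub_coreVanishing m X D hm1 hm2 ℓ hℓ e (hprim e he) ⟨hT, hK⟩ c₀ hc₀P hc₀Q hc₀H
        rw [h0]
        exact Submodule.zero_mem _
  · -- the Lefschetz part lands in the third typed summand
    exact Submodule.mem_sup_right (Submodule.subset_span ⟨a, haQ, haH, ℓ, hℓ.1, rfl⟩)

end Summit.HodgeConjecture.HodgeConjecture.Cruxes.MiddleThetaSpan.ConjugateDimensionSieve

end
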